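import Literature.Geometry.Riemannian.MetricFlowDistanceDistortion
import HarnessLib

/-!
# The metric on `𝒳_s ⊔ 𝒳_t` coupling two time-slices (Bamler 2023, §4.2, Lemma
# (construction of `Z`))

R. Bamler, *Compactness theory of the space of super Ricci flows*, Invent. Math. 233 (2023), §4.2,
Lemma (construction of `Z`), first part: *"Let `0 < δ ≤ ε` … Suppose that there is a non-empty,
measurable subset `W ⊂ 𝒳_t` such that for any `y₁, y₂ ∈ W` we have
`0 ≤ d_t(y₁, y₂) − d^{𝒳_s}_{W₁}(ν_{y₁;s}, ν_{y₂;s}) ≤ δ` (4.9). Then there is a metric space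
`(Z, d_Z)` and isometric embeddings `φ_s : 𝒳_s → Z`, `φ_t : 𝒳_t → Z` such that (4.7) holds"*,
i.e. `d_Z(φ_s(x), φ_t(y)) ≤ d^{𝒳_s}_{W₁}(δ_x, ν_{y;s}) + δ` for `x ∈ 𝒳_s`, `y ∈ W`. Printed proof:
`Z := 𝒳_s ⊔ 𝒳_t`, `d_Z = d_s, d_t` on the pieces and
`d_Z(φ_s(x), φ_t(y)) := inf_{w ∈ W} (d_t(y, w) + d^{𝒳_s}_{W₁}(δ_x, ν_{w;s})) + δ` (4.11), the
triangle inequality being checked case by case from `d_{W₁}(δ_{x₁}, ν_{w;s}) ≤ d_s(x₁, x₂) +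
d_{W₁}(δ_{x₂}, ν_{w;s})`, (4.9) and `d_{W₁}(ν_{w₁;s}, ν_{w₂;s}) ≤ d_t(w₁, w₂)`.

We separate the elementary metric geometry from the flow: `CrossMetricSum c W δ` is the disjoint
union `A ⊕ B` of two metric spaces with the metric (4.11) built from a "cross cost"
`c : A → B → ℝ` subject to the three inequalities the printed proof uses; the metric-flow
instance takes `c(x, w) := d^{𝒳_s}_{W₁}(δ_x, ν_{w;s})`.

* `CrossMetricSum`, `CrossMetricSum.instMetricSpace` — the space `(Z, d_Z)` of (4.11);
* `CrossMetricSum.isometry_inl/inr`, `CrossMetricSum.dist_inl_inr_le` — isometric embeddings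
  and the bound `d_Z(φ_A(x), φ_B(y)) ≤ c(x, y) + δ` for `y ∈ W`;
* `MetricFlow.wassersteinW1_dirac_dirac`, `MetricFlow.wassersteinW1_dirac_condKernel_ne_top`,
  … — the `d_{W₁}` facts feeding the hypotheses;
* `MetricFlow.exists_sliceUnion` — **the Lemma (first part)** for metric flows.

Everything is proved; the only definitions are the type synonym and its metric; no named facts.

## References

* R. H. Bamler, *Compactness theory of the space of super Ricci flows*, Invent. Math. 233 (2023),
  §4.2, Lemma (construction of `Z`), (4.9)–(4.11), and Proposition (closeness of nearby
  time-slices), (4.7). [Bamler2023]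
-/

noncomputable section

open Set MeasureTheory Filter Topology Metric
open scoped ENNReal NNReal

namespace Literature.Geometry.Riemannian

universe u v

/-! ### The abstract construction: `A ⊔ B` with the metric (4.11) -/

namespace CrossMetricSum

variable {A : Type u} {B : Type v} [MetricSpace A] [MetricSpace B] {c : A → B → ℝ} {W : Set B}
  {δ : ℝ}

/-- The cross distance `D(x, y) := inf_{w ∈ W} (d_B(y, w) + c(x, w)) + δ` of (4.11).
[cite: Bamler2023, §4.2, Lemma (construction of Z), (4.11)] -/
def crossDist (c : A → B → ℝ) (W : Set B) (δ : ℝ) (x : A) (y : B) : ℝ :=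
  (⨅ w : W, (dist y (w : B) + c x w)) + δ

/-- The distance function of (4.11) on `A ⊔ B`. [cite: Bamler2023, §4.2, Lemma (construction of Z), (4.11)] -/
def sumDist (c : A → B → ℝ) (W : Set B) (δ : ℝ) : A ⊕ B → A ⊕ B → ℝ
  | .inl x₁, .inl x₂ => dist x₁ x₂
  | .inr y₁, .inr y₂ => dist y₁ y₂
  | .inl x, .inr y => crossDist c W δ x y
  | .inr y, .inl x => crossDist c W δ x y

/-- The hypotheses of the construction (all used verbatim in the printed proof): `W ≠ ∅`,
`δ > 0`, `c ≥ 0`, `c(·, w)` is `1`-Lipschitz, (4.9) in the form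
`d_B(w₁, w₂) ≤ c(x, w₁) + c(x, w₂) + δ` on `W`, and `d_A(x₁, x₂) ≤ c(x₁, w₁) + d_B(w₁, w₂) + c(x₂, w₂)`
on `W`. [cite: Bamler2023, §4.2, Lemma (construction of Z), proof] -/
structure Hyp (c : A → B → ℝ) (W : Set B) (δ : ℝ) : Prop where
  nonempty : W.Nonempty
  pos : 0 < δ
  nonneg : ∀ x w, 0 ≤ c x w
  lip : ∀ x₁ x₂ w, c x₁ w ≤ dist x₁ x₂ + c x₂ w
  cross : ∀ x, ∀ w₁ ∈ W, ∀ w₂ ∈ W, dist w₁ w₂ ≤ c x w₁ + c x w₂ + δ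
  far : ∀ x₁ x₂, ∀ w₁ ∈ W, ∀ w₂ ∈ W, dist x₁ x₂ ≤ c x₁ w₁ + dist w₁ w₂ + c x₂ w₂

end CrossMetricSum

/-- **The disjoint union `A ⊔ B` carrying the coupling metric (4.11)** of Bamler 2023, §4.2,
Lemma (construction of `Z`): a type synonym of `A ⊕ B` depending on (a proof of the hypotheses
on) the cross cost `c : A → B → ℝ`, the set `W ⊆ B` and the gap `δ`.
[cite: Bamler2023, §4.2, Lemma (construction of Z), (4.11)] -/
@[nolint unusedArguments]
def CrossMetricSum {A : Type u} {B : Type v} [MetricSpace A] [MetricSpace B] {c : A → B → ℝ}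
    {W : Set B} {δ : ℝ} (_h : CrossMetricSum.Hyp c W δ) : Type (max u v) :=
  A ⊕ B

namespace CrossMetricSum

variable {A : Type u} {B : Type v} [MetricSpace A] [MetricSpace B] {c : A → B → ℝ} {W : Set B}
  {δ : ℝ}

/-- `φ_A : A → Z`. [cite: Bamler2023, §4.2, Lemma (construction of Z)] -/
def inl (h : Hyp c W δ) : A → CrossMetricSum h := Sum.inl

/-- `φ_B : B → Z`. [cite: Bamler2023, §4.2, Lemma (construction of Z)] -/
def inr (h : Hyp c W δ) : B → CrossMetricSum h := Sum.inr

section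

variable (h : Hyp c W δ)
include h

/-- The terms of the infimum (4.11) are bounded below by `0`. [cite: Bamler2023, §4.2, Lemma (construction of Z), proof] -/
private theorem bdd (x : A) (y : B) : BddBelow (range fun w : W ↦ dist y (w : B) + c x w) :=
  ⟨0, by rintro _ ⟨w, rfl⟩; exact add_nonneg dist_nonneg (h.nonneg _ _)⟩

/-- `W` is nonempty as a type. [cite: Bamler2023, §4.2, Lemma (construction of Z), proof] -/
private theorem ne : Nonempty W := h.nonempty.to_subtype

/-- `D(x, y) ≤ d(y, w) + c(x, w) + δ` for `w ∈ W`. [cite: Bamler2023, §4.2, Lemma (construction of Z), proof] -/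
theorem crossDist_le {x : A} {y : B} {w : B} (hw : w ∈ W) :
    crossDist c W δ x y ≤ dist y w + c x w + δ :=
  add_le_add (ciInf_le (bdd h x y) ⟨w, hw⟩) le_rfl

/-- Lower bounds for `D(x, y)` are checked term by term. [cite: Bamler2023, §4.2, Lemma (construction of Z), proof] -/
theorem le_crossDist {x : A} {y : B} {b : ℝ} (hb : ∀ w ∈ W, b ≤ dist y w + c x w + δ) :
    b ≤ crossDist c W δ x y := by
  haveI := ne h
  have h1 : b - δ ≤ ⨅ w : W, (dist y (w : B) + c x w) :=
    le_ciInf fun w ↦ by linarith [hb w w.2]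
  unfold crossDist
  linarith

/-- `D ≥ δ`. [cite: Bamler2023, §4.2, Lemma (construction of Z), proof] -/
theorem delta_le_crossDist (x : A) (y : B) : δ ≤ crossDist c W δ x y := by
  haveI := ne h
  have h1 : 0 ≤ ⨅ w : W, (dist y (w : B) + c x w) :=
    le_ciInf fun w ↦ add_nonneg dist_nonneg (h.nonneg _ _)
  unfold crossDist
  linarith

/-- Triangle inequality, case `A A B`: `D(x₁, y) ≤ d(x₁, x₂) + D(x₂, y)` (from the Lipschitz
property of `c`). [cite: Bamler2023, §4.2, Lemma (construction of Z), proof] -/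
theorem crossDist_le_dist_add (x₁ x₂ : A) (y : B) :
    crossDist c W δ x₁ y ≤ dist x₁ x₂ + crossDist c W δ x₂ y := by
  have key : crossDist c W δ x₁ y - dist x₁ x₂ ≤ crossDist c W δ x₂ y := by
    refine le_crossDist h fun w hw ↦ ?_
    have := crossDist_le h (x := x₁) (y := y) hw
    linarith [h.lip x₁ x₂ w]
  linarith

/-- Triangle inequality, case `A B B`: `D(x, y₂) ≤ D(x, y₁) + d(y₁, y₂)`. [cite: Bamler2023, §4.2, Lemma (construction of Z), proof] -/
theorem crossDist_le_crossDist_add (x : A) (y₁ y₂ : B) :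
    crossDist c W δ x y₂ ≤ crossDist c W δ x y₁ + dist y₁ y₂ := by
  have key : crossDist c W δ x y₂ - dist y₁ y₂ ≤ crossDist c W δ x y₁ := by
    refine le_crossDist h fun w hw ↦ ?_
    have := crossDist_le h (x := x) (y := y₂) hw
    linarith [dist_triangle y₂ y₁ w, dist_comm y₁ y₂]
  linarith

/-- Triangle inequality, case `B A B`: `d(y₁, y₂) ≤ D(x, y₁) + D(x, y₂)` (from (4.9)). [cite: Bamler2023, §4.2, Lemma (construction of Z), proof] -/
theorem dist_le_crossDist_add_crossDist (x : A) (y₁ y₂ : B) :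
    dist y₁ y₂ ≤ crossDist c W δ x y₁ + crossDist c W δ x y₂ := by
  -- `dist y₁ y₂ - D(x, y₂) ≤ D(x, y₁)`
  have key : dist y₁ y₂ - crossDist c W δ x y₂ ≤ crossDist c W δ x y₁ := by
    refine le_crossDist h fun w₁ hw₁ ↦ ?_
    -- `dist y₁ y₂ - (dist y₁ w₁ + c x w₁ + δ) ≤ D(x, y₂)`
    have key' : dist y₁ y₂ - (dist y₁ w₁ + c x w₁ + δ) ≤ crossDist c W δ x y₂ := by
      refine le_crossDist h fun w₂ hw₂ ↦ ?_
      linarith [h.cross x w₁ hw₁ w₂ hw₂, dist_triangle4 y₁ w₁ w₂ y₂, dist_comm y₂ w₂,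
        h.pos]
    linarith
  linarith

/-- Triangle inequality, case `A B A`: `d(x₁, x₂) ≤ D(x₁, y) + D(x₂, y)`. [cite: Bamler2023, §4.2, Lemma (construction of Z), proof] -/
theorem dist_le_crossDist_add_crossDist' (x₁ x₂ : A) (y : B) :
    dist x₁ x₂ ≤ crossDist c W δ x₁ y + crossDist c W δ x₂ y := by
  have key : dist x₁ x₂ - crossDist c W δ x₂ y ≤ crossDist c W δ x₁ y := by
    refine le_crossDist h fun w₁ hw₁ ↦ ?_
    have key' : dist x₁ x₂ - (dist y w₁ + c x₁ w₁ + δ) ≤ crossDist c W δ x₂ y := by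
      refine le_crossDist h fun w₂ hw₂ ↦ ?_
      linarith [h.far x₁ x₂ w₁ hw₁ w₂ hw₂, dist_triangle w₁ y w₂, dist_comm y w₁, h.pos]
    linarith
  linarith

end

/-- **`(Z, d_Z)`: the metric (4.11) on `A ⊔ B` is a metric** (Bamler 2023, §4.2, proof of the
Lemma (construction of `Z`): *"We need to verify that `d_Z` satisfies the triangle
inequality"* — the four mixed cases above; points of `A` and `B` are at distance `≥ δ > 0`).
[cite: Bamler2023, §4.2, Lemma (construction of Z), proof] -/
instance instMetricSpace (h : Hyp c W δ) : MetricSpace (CrossMetricSum h) where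
  dist := sumDist c W δ
  dist_self p := by rcases p with x | y <;> exact dist_self _
  dist_comm p q := by
    rcases p with x₁ | y₁ <;> rcases q with x₂ | y₂
    · exact dist_comm x₁ x₂
    · rfl
    · rfl
    · exact dist_comm y₁ y₂
  dist_triangle p q r := by
    rcases p with x₁ | y₁ <;> rcases q with x₂ | y₂ <;> rcases r with x₃ | y₃
    · exact dist_triangle x₁ x₂ x₃
    · exact crossDist_le_dist_add h x₁ x₂ y₃
    · exact dist_le_crossDist_add_crossDist' h x₁ x₃ y₂
    · exact crossDist_le_crossDist_add h x₁ y₂ y₃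
    · show crossDist c W δ x₃ y₁ ≤ crossDist c W δ x₂ y₁ + dist x₂ x₃
      rw [add_comm, dist_comm]
      exact crossDist_le_dist_add h x₃ x₂ y₁
    · exact dist_le_crossDist_add_crossDist h x₂ y₁ y₃
    · show crossDist c W δ x₃ y₁ ≤ dist y₁ y₂ + crossDist c W δ x₃ y₂
      rw [add_comm, dist_comm]
      exact crossDist_le_crossDist_add h x₃ y₂ y₁
    · exact dist_triangle y₁ y₂ y₃
  eq_of_dist_eq_zero {p q} hpq := by
    rcases p with x₁ | y₁ <;> rcases q with x₂ | y₂
    · exact congrArg Sum.inl (eq_of_dist_eq_zero hpq)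
    · exact absurd hpq (ne_of_gt (h.pos.trans_le (delta_le_crossDist h x₁ y₂)))
    · exact absurd hpq (ne_of_gt (h.pos.trans_le (delta_le_crossDist h x₂ y₁)))
    · exact congrArg Sum.inr (eq_of_dist_eq_zero hpq)

section

variable (h : Hyp c W δ)

/-- `φ_A := inl` is an isometric embedding. [cite: Bamler2023, §4.2, Lemma (construction of Z)] -/
theorem isometry_inl : Isometry (inl h) :=
  Isometry.of_dist_eq fun _ _ ↦ rfl

/-- `φ_B := inr` is an isometric embedding. [cite: Bamler2023, §4.2, Lemma (construction of Z)] -/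
theorem isometry_inr : Isometry (inr h) :=
  Isometry.of_dist_eq fun _ _ ↦ rfl

/-- The distance between the two pieces is the cross distance (4.11).
[cite: Bamler2023, §4.2, Lemma (construction of Z), (4.11)] -/
theorem dist_inl_inr (x : A) (y : B) : dist (inl h x) (inr h y) = crossDist c W δ x y := rfl

/-- **(4.7), first inequality**: `d_Z(φ_A(x), φ_B(y)) ≤ c(x, y) + δ` for `y ∈ W` (take `w = y`
in (4.11)). [cite: Bamler2023, §4.2, Proposition (closeness of nearby time-slices), (4.7)] -/
theorem dist_inl_inr_le (x : A) {y : B} (hy : y ∈ W) : dist (inl h x) (inr h y) ≤ c x y + δ := by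
  have h1 := crossDist_le h (x := x) (y := y) hy
  rw [dist_self, zero_add] at h1
  exact h1

/-- The two pieces are at distance `≥ δ`. [cite: Bamler2023, §4.2, Lemma (construction of Z), (4.11)] -/
theorem delta_le_dist_inl_inr (x : A) (y : B) : δ ≤ dist (inl h x) (inr h y) :=
  delta_le_crossDist h x y

/-- Every point of `Z` comes from `A` or from `B`. [cite: Bamler2023, §4.2, Lemma (construction of Z)] -/
theorem range_inl_union_range_inr : range (inl h) ∪ range (inr h) = univ := by
  ext p
  simp only [mem_union, mem_range, mem_univ, iff_true]
  rcases p with x | y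
  · exact Or.inl ⟨x, rfl⟩
  · exact Or.inr ⟨y, rfl⟩

end

end CrossMetricSum

/-! ### `d_{W₁}` against Dirac masses -/

section Dirac

variable {X : Type u} [MetricSpace X] [MeasurableSpace X] [BorelSpace X] [SecondCountableTopology X]

/-- **`d_{W₁}(δ_{x₁}, δ_{x₂}) = d(x₁, x₂)`** (used in Bamler 2023, §4.2, proof of the Lemma
(construction of `Z`): `d_{W₁}(δ_{x₁}, δ_{x₂}) = d_s(x₁, x₂)`): the coupling `δ_{(x₁, x₂)}` gives
`≤`, the `1`-Lipschitz bounded function `min(d(·, x₂), d(x₁, x₂))` gives `≥`.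
[cite: Bamler2023, §4.2, Lemma (construction of Z), proof] -/
theorem wassersteinW1_dirac_dirac (x₁ x₂ : X) :
    wassersteinW1 (Measure.dirac x₁) (Measure.dirac x₂) = edist x₁ x₂ := by
  refine le_antisymm ?_ ?_
  · have hc : IsCoupling (Measure.dirac x₁) (Measure.dirac x₂) (Measure.dirac (x₁, x₂)) :=
      ⟨inferInstance, by rw [Measure.fst, Measure.map_dirac' measurable_fst],
        by rw [Measure.snd, Measure.map_dirac' measurable_snd]⟩
    refine (wassersteinW1_le_lintegral hc).trans_eq ?_
    rw [lintegral_dirac]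
  · set u : X → ℝ := fun z ↦ min (dist z x₂) (dist x₁ x₂) with hu
    have hum : Measurable u := (continuous_id.dist continuous_const).min continuous_const |>.measurable
    have hC : ∀ z, |u z| ≤ dist x₁ x₂ := fun z ↦ by
      rw [abs_of_nonneg (le_min dist_nonneg dist_nonneg)]
      exact min_le_right _ _
    have hlip : LipschitzWith 1 u := (LipschitzWith.dist_left x₂).min_const (dist x₁ x₂)
    have h := ofReal_integral_sub_integral_le_wassersteinW1 (Measure.dirac x₁) (Measure.dirac x₂)
      hum hC hlip
    have h2 : u x₁ - u x₂ = dist x₁ x₂ := by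
      simp only [hu, dist_self, min_self, min_eq_left dist_nonneg, sub_zero]
    rwa [integral_dirac, integral_dirac, h2, ← edist_dist] at h

/-- `d_{W₁}(δ_x, ν) < ∞` for a probability measure `ν` on a compact metric space.
[folklore] -/
theorem wassersteinW1_dirac_ne_top [CompactSpace X] (x : X) (ν : Measure X) [IsProbabilityMeasure ν] :
    wassersteinW1 (Measure.dirac x) ν ≠ ∞ := by
  have hb : ∀ a b : X, edist a b ≤ Metric.ediam (univ : Set X) := fun a b ↦
    Metric.edist_le_ediam_of_mem (mem_univ _) (mem_univ _)
  have htop : Metric.ediam (univ : Set X) ≠ ∞ := isCompact_univ.isBounded.ediam_ne_top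
  refine ne_top_of_le_ne_top htop ?_
  calc wassersteinW1 (Measure.dirac x) ν ≤ ∫⁻ a, ∫⁻ b, edist a b ∂ν ∂(Measure.dirac x) :=
        wassersteinW1_le_lintegral_prod _ _
    _ ≤ ∫⁻ _, ∫⁻ _, Metric.ediam (univ : Set X) ∂ν ∂(Measure.dirac x) :=
        lintegral_mono fun a ↦ lintegral_mono fun b ↦ hb a b
    _ = Metric.ediam (univ : Set X) := by
        rw [lintegral_const, lintegral_const, measure_univ, measure_univ, mul_one, mul_one]

end Dirac

/-! ### The metric flow instance: `Z = 𝒳_s ⊔ 𝒳_t` -/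

namespace MetricFlow

variable {I : Set ℝ} {𝒳 : MetricFlow.{u} I}

variable (𝒳) in
/-- The cross cost `c(x, w) := d^{𝒳_s}_{W₁}(δ_x, ν_{w;s})` of (4.11), as a real number.
[cite: Bamler2023, §4.2, Lemma (construction of Z), (4.11)] -/
def sliceCost (s t : I) (x : 𝒳.Slice s) (w : 𝒳.Slice t) : ℝ :=
  (wassersteinW1 (Measure.dirac x) (𝒳.condKernel w s)).toReal

/-- **The hypotheses of the construction of `Z = 𝒳_s ⊔ 𝒳_t` hold** (Bamler 2023, §4.2, proof of
the Lemma (construction of `Z`)): for a compact slice `𝒳_s`, `s ≤ t`, a nonempty `W ⊆ 𝒳_t`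
with (4.9) `d_t(w₁, w₂) ≤ d_{W₁}(ν_{w₁;s}, ν_{w₂;s}) + δ` on `W`, and `δ > 0`, the cross cost
`c(x, w) = d_{W₁}(δ_x, ν_{w;s})` is `1`-Lipschitz in `x` (`d_{W₁}(δ_{x₁}, ν) ≤ d_s(x₁, x₂) +
d_{W₁}(δ_{x₂}, ν)`), satisfies `d_t(w₁, w₂) ≤ c(x, w₁) + c(x, w₂) + δ` and
`d_s(x₁, x₂) = d_{W₁}(δ_{x₁}, δ_{x₂}) ≤ c(x₁, w₁) + d_{W₁}(ν_{w₁;s}, ν_{w₂;s}) + c(x₂, w₂) ≤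
c(x₁, w₁) + d_t(w₁, w₂) + c(x₂, w₂)` ((c) of §3.2).
[cite: Bamler2023, §4.2, Lemma (construction of Z), proof] -/
theorem sliceCost_hyp {s t : I} [CompactSpace (𝒳.Slice s)] (hst : (s : ℝ) ≤ t)
    {W : Set (𝒳.Slice t)} (hW : W.Nonempty) {δ : ℝ} (hδ : 0 < δ)
    (h49 : ∀ w₁ ∈ W, ∀ w₂ ∈ W, edist w₁ w₂ ≤
      wassersteinW1 (𝒳.condKernel w₁ s) (𝒳.condKernel w₂ s) + ENNReal.ofReal δ) :
    CrossMetricSum.Hyp (𝒳.sliceCost s t) W δ := by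
  haveI : SecondCountableTopology (𝒳.Slice s) := UniformSpace.secondCountable_of_separable _
  haveI : ∀ w : 𝒳.Slice t, IsProbabilityMeasure (𝒳.condKernel w s) := fun w ↦
    𝒳.isProbabilityMeasure_condKernel w hst
  -- abbreviations and finiteness
  have hfin : ∀ (x : 𝒳.Slice s) (w : 𝒳.Slice t),
      wassersteinW1 (Measure.dirac x) (𝒳.condKernel w s) ≠ ∞ := fun x w ↦
    wassersteinW1_dirac_ne_top x _
  have hcoe : ∀ (x : 𝒳.Slice s) (w : 𝒳.Slice t),
      ENNReal.ofReal (𝒳.sliceCost s t x w) = wassersteinW1 (Measure.dirac x) (𝒳.condKernel w s) :=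
    fun x w ↦ ENNReal.ofReal_toReal (hfin x w)
  have hnn : ∀ (x : 𝒳.Slice s) (w : 𝒳.Slice t), 0 ≤ 𝒳.sliceCost s t x w := fun x w ↦
    ENNReal.toReal_nonneg
  -- a real inequality follows from its `[0, ∞]` version with finite right-hand side
  have key : ∀ {a : ℝ} {b : ℝ≥0∞} {r : ℝ}, 0 ≤ r → ENNReal.ofReal a ≤ b → b ≤ ENNReal.ofReal r →
      a ≤ r := fun hr hab hbr ↦ (ENNReal.ofReal_le_ofReal_iff hr).1 (hab.trans hbr)
  refine ⟨hW, hδ, hnn, fun x₁ x₂ w ↦ ?_, fun x w₁ hw₁ w₂ hw₂ ↦ ?_, fun x₁ x₂ w₁ hw₁ w₂ hw₂ ↦ ?_⟩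
  · -- `c(x₁, w) ≤ d_s(x₁, x₂) + c(x₂, w)`
    refine key (add_nonneg dist_nonneg (hnn _ _)) (hcoe x₁ w).le ?_
    rw [ENNReal.ofReal_add dist_nonneg (hnn _ _), hcoe, ← edist_dist, ← wassersteinW1_dirac_dirac]
    exact wassersteinW1_triangle _ _ _
  · -- `d_t(w₁, w₂) ≤ c(x, w₁) + c(x, w₂) + δ`
    refine key (by linarith [hnn x w₁, hnn x w₂]) (le_of_eq (edist_dist w₁ w₂).symm) ?_
    rw [ENNReal.ofReal_add (add_nonneg (hnn _ _) (hnn _ _)) hδ.le,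
      ENNReal.ofReal_add (hnn _ _) (hnn _ _), hcoe, hcoe, wassersteinW1_comm (Measure.dirac x)]
    refine (h49 w₁ hw₁ w₂ hw₂).trans (add_le_add ?_ le_rfl)
    exact wassersteinW1_triangle _ _ _
  · -- `d_s(x₁, x₂) ≤ c(x₁, w₁) + d_t(w₁, w₂) + c(x₂, w₂)`
    refine key (by linarith [hnn x₁ w₁, hnn x₂ w₂, dist_nonneg (x := w₁) (y := w₂)])
      (le_of_eq (edist_dist x₁ x₂).symm) ?_
    rw [ENNReal.ofReal_add (add_nonneg (hnn _ _) dist_nonneg) (hnn _ _),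
      ENNReal.ofReal_add (hnn _ _) dist_nonneg, hcoe, hcoe, ← edist_dist,
      ← wassersteinW1_dirac_dirac, wassersteinW1_comm (Measure.dirac x₂)]
    calc wassersteinW1 (Measure.dirac x₁) (Measure.dirac x₂)
        ≤ wassersteinW1 (Measure.dirac x₁) (𝒳.condKernel w₂ s) +
            wassersteinW1 (𝒳.condKernel w₂ s) (Measure.dirac x₂) := wassersteinW1_triangle _ _ _
      _ ≤ (wassersteinW1 (Measure.dirac x₁) (𝒳.condKernel w₁ s) +
            wassersteinW1 (𝒳.condKernel w₁ s) (𝒳.condKernel w₂ s)) +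
            wassersteinW1 (𝒳.condKernel w₂ s) (Measure.dirac x₂) :=
          add_le_add (wassersteinW1_triangle _ _ _) le_rfl
      _ ≤ (wassersteinW1 (Measure.dirac x₁) (𝒳.condKernel w₁ s) + edist w₁ w₂) +
            wassersteinW1 (𝒳.condKernel w₂ s) (Measure.dirac x₂) := by
          gcongr
          exact 𝒳.wassersteinW1_condKernel_le_edist hst w₁ w₂

/-- **Bamler 2023, §4.2, Lemma (construction of `Z`), first part**: for a compact slice `𝒳_s`,
`s ≤ t`, a nonempty `W ⊆ 𝒳_t` satisfying (4.9) with `δ > 0`, the space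
`Z := CrossMetricSum (sliceCost_hyp …) = 𝒳_s ⊔ 𝒳_t` with the metric (4.11) receives isometric
embeddings `φ_s = inl`, `φ_t = inr` (`CrossMetricSum.isometry_inl/inr`) with
**`d_Z(φ_s(x), φ_t(y)) ≤ d^{𝒳_s}_{W₁}(δ_x, ν_{y;s}) + δ` for `x ∈ 𝒳_s`, `y ∈ W`** — the first
inequality of (4.7). [cite: Bamler2023, §4.2, Lemma (construction of Z); Proposition (closeness of nearby time-slices), (4.7)] -/
theorem edist_inl_inr_le_wassersteinW1_dirac_add {s t : I} [CompactSpace (𝒳.Slice s)]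
    (hst : (s : ℝ) ≤ t) {W : Set (𝒳.Slice t)} (hW : W.Nonempty) {δ : ℝ} (hδ : 0 < δ)
    (h49 : ∀ w₁ ∈ W, ∀ w₂ ∈ W, edist w₁ w₂ ≤
      wassersteinW1 (𝒳.condKernel w₁ s) (𝒳.condKernel w₂ s) + ENNReal.ofReal δ)
    (x : 𝒳.Slice s) {y : 𝒳.Slice t} (hy : y ∈ W) :
    edist (CrossMetricSum.inl (𝒳.sliceCost_hyp hst hW hδ h49) x)
        (CrossMetricSum.inr (𝒳.sliceCost_hyp hst hW hδ h49) y) ≤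
      wassersteinW1 (Measure.dirac x) (𝒳.condKernel y s) + ENNReal.ofReal δ := by
  haveI : SecondCountableTopology (𝒳.Slice s) := UniformSpace.secondCountable_of_separable _
  haveI := 𝒳.isProbabilityMeasure_condKernel y hst
  have h1 := CrossMetricSum.dist_inl_inr_le (𝒳.sliceCost_hyp hst hW hδ h49) x hy
  rw [edist_dist, ← ENNReal.ofReal_toReal (wassersteinW1_dirac_ne_top x (𝒳.condKernel y s)),
    ← ENNReal.ofReal_add ENNReal.toReal_nonneg hδ.le]
  exact ENNReal.ofReal_le_ofReal h1

end MetricFlow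

end Literature.Geometry.Riemannian

end
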